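import Summits.HubbardSuperconductivity.HubbardSuperconductivity.Theorems.LevyLogBootstrapDressHalfFilledPairResolventApprox
import HarnessLib

/-!
# Crux `DressHalfFilled` (stmt-HubbardSuperconductivity-8148), stub `stub_plaquetteData`, certificate (W1):
# perturbation of a FAMILY SUM of pair resolvents and the projection onto a trial vector

Support file (`--supports stmt-HubbardSuperconductivity-8148`), continuing `…PairResolventApprox`. The (W1) certificates
(`…W1Certs*`) evaluate the family sums `Σ_{y',y} K(E; a'_{y'}, b'_y; c'_{y'}, d'_y)` for the operator-inserted TRIAL states
`a' = β • c Γψ`, …; the kernel entries need them for the abstract plaquette states `a = c φ`, …, `φ = β Γψ + w`,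
`‖w‖ ≤ ε`. This file provides the three generic bridges:

* `pairResolvent_family_perturb_le` — `(θ₁+θ₂-E)·|Σ_{k',k} K(a,b,c,d) - Σ_{k',k} K(a',b',c',d')| ≤ 4(ε₁+ε₂+ε₃+ε₄)` on
  two blocks with form floors, when `‖a_{k'} - a'_{k'}‖ ≤ ε₁`, … and all vectors have norm `≤ 1` (`pairResolvent_perturb_le`
  summed over the four pairs);
* `pairResolvent_family_smul` — scalars pull out of the family sum: `Σ K(x₁•a, x₂•b, x₃•c, x₄•d) = x̄₁ x₂ x̄₃ x₄ · Σ K(a,b,c,d)`;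
* `eucNorm_sub_proj_sq'` — for a unit `φ` and any `ψ ≠ 0`, `‖φ - (⟨ψ,φ⟩/‖ψ‖²) ψ‖² = 1 - |⟨ψ,φ⟩|²/‖ψ‖²`, and
  `‖(⟨ψ,φ⟩/‖ψ‖²) • ψ‖ ≤ 1` (`norm_proj_coeff_smul_le`).

Sources: T. Kato (1966) I-§5.3; elementary Hilbert-space geometry. No definition and no named fact is introduced; sorry-free.
-/

noncomputable section

set_option linter.dupNamespace false

namespace Summit.HubbardSuperconductivity.HubbardSuperconductivity.Theorems.LevyLogBootstrap

open Matrix Finset Literature.MathematicalPhysics.QuantumLattice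
open scoped ComplexOrder

section Generic

variable {m : Type*} [Fintype m] [DecidableEq m]

/-- Monotonicity of a product of four nonnegative reals. [folklore] -/
theorem prod4_le {x₁ x₂ x₃ x₄ u₁ u₂ u₃ u₄ : ℝ} (h0₁ : 0 ≤ x₁) (h0₂ : 0 ≤ x₂) (h0₃ : 0 ≤ x₃) (h0₄ : 0 ≤ x₄)
    (h₁ : x₁ ≤ u₁) (h₂ : x₂ ≤ u₂) (h₃ : x₃ ≤ u₃) (h₄ : x₄ ≤ u₄) :
    x₁ * x₂ * x₃ * x₄ ≤ u₁ * u₂ * u₃ * u₄ := by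
  have hu₁ : 0 ≤ u₁ := h0₁.trans h₁
  have hu₂ : 0 ≤ u₂ := h0₂.trans h₂
  have hu₃ : 0 ≤ u₃ := h0₃.trans h₃
  have h12 : x₁ * x₂ ≤ u₁ * u₂ := mul_le_mul h₁ h₂ h0₂ hu₁
  have h123 : x₁ * x₂ * x₃ ≤ u₁ * u₂ * u₃ := mul_le_mul h12 h₃ h0₃ (mul_nonneg hu₁ hu₂)
  exact mul_le_mul h123 h₄ h0₄ (mul_nonneg (mul_nonneg hu₁ hu₂) hu₃)

/-- **Perturbation of a family sum of pair resolvents.** Blocks `p₁ ∋ a, a', b, b'`, `p₂ ∋ c, c', d, d'` with floors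
`θ₁, θ₂`, `E < θ₁ + θ₂`; if `‖a_{k'} - a'_{k'}‖ ≤ ε₁`, `‖b_k - b'_k‖ ≤ ε₂`, `‖c_{k'} - c'_{k'}‖ ≤ ε₃`, `‖d_k - d'_k‖ ≤ ε₄` and
`‖a'‖, ‖b‖, ‖b'‖, ‖c‖, ‖c'‖, ‖d‖ ≤ 1`, then
`(θ₁+θ₂-E)·|Σ_{k',k} K(a_{k'},b_k,c_{k'},d_k) - Σ_{k',k} K(a'_{k'},b'_k,c'_{k'},d'_k)| ≤ 4(ε₁+ε₂+ε₃+ε₄)` (families of two).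
[folklore] -/
theorem pairResolvent_family_perturb_le {H : Matrix m m ℂ} (hH : H.IsHermitian) (p₁ p₂ : m → Prop)
    [DecidablePred p₁] [DecidablePred p₂] (hK₁ : ∀ j k, ¬ p₁ j → p₁ k → H j k = 0)
    (hK₂ : ∀ j k, ¬ p₂ j → p₂ k → H j k = 0) {θ₁ θ₂ E : ℝ}
    (hθ₁ : ∀ u : m → ℂ, (∀ j, ¬ p₁ j → u j = 0) → θ₁ * (star u ⬝ᵥ u).re ≤ (star u ⬝ᵥ H *ᵥ u).re)
    (hθ₂ : ∀ u : m → ℂ, (∀ j, ¬ p₂ j → u j = 0) → θ₂ * (star u ⬝ᵥ u).re ≤ (star u ⬝ᵥ H *ᵥ u).re)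
    (hE : E < θ₁ + θ₂) {a a' c c' b b' d d' : Fin 2 → m → ℂ}
    (ha : ∀ k j, ¬ p₁ j → a k j = 0) (ha' : ∀ k j, ¬ p₁ j → a' k j = 0)
    (hb : ∀ k j, ¬ p₁ j → b k j = 0) (hb' : ∀ k j, ¬ p₁ j → b' k j = 0)
    (hc : ∀ k j, ¬ p₂ j → c k j = 0) (hc' : ∀ k j, ¬ p₂ j → c' k j = 0)
    (hd : ∀ k j, ¬ p₂ j → d k j = 0) (hd' : ∀ k j, ¬ p₂ j → d' k j = 0)
    {ε₁ ε₂ ε₃ ε₄ : ℝ}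
    (h₁ : ∀ k, eucNorm (a k - a' k) ≤ ε₁) (h₂ : ∀ k, eucNorm (b k - b' k) ≤ ε₂)
    (h₃ : ∀ k, eucNorm (c k - c' k) ≤ ε₃) (h₄ : ∀ k, eucNorm (d k - d' k) ≤ ε₄)
    (na' : ∀ k, eucNorm (a' k) ≤ 1) (nb : ∀ k, eucNorm (b k) ≤ 1) (nb' : ∀ k, eucNorm (b' k) ≤ 1)
    (nc : ∀ k, eucNorm (c k) ≤ 1) (nc' : ∀ k, eucNorm (c' k) ≤ 1) (nd : ∀ k, eucNorm (d k) ≤ 1) :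
    (θ₁ + θ₂ - E) *
        ‖(∑ k' : Fin 2, ∑ k : Fin 2, pairResolvent hH E (a k') (b k) (c k') (d k)) -
          ∑ k' : Fin 2, ∑ k : Fin 2, pairResolvent hH E (a' k') (b' k) (c' k') (d' k)‖ ≤
      4 * (ε₁ + ε₂ + ε₃ + ε₄) := by
  have hg : 0 < θ₁ + θ₂ - E := by linarith
  -- one pair
  have one : ∀ k' k, (θ₁ + θ₂ - E) * ‖pairResolvent hH E (a k') (b k) (c k') (d k) -
      pairResolvent hH E (a' k') (b' k) (c' k') (d' k)‖ ≤ ε₁ + ε₂ + ε₃ + ε₄ := by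
    intro k' k
    have h := pairResolvent_perturb_le hH p₁ p₂ hK₁ hK₂ hθ₁ hθ₂ hE (ha k') (ha' k') (hb k) (hb' k) (hc k') (hc' k')
      (hd k) (hd' k)
    have e1 : eucNorm (a k' - a' k') * eucNorm (b k) * eucNorm (c k') * eucNorm (d k) ≤ ε₁ * 1 * 1 * 1 :=
      prod4_le (eucNorm_nonneg _) (eucNorm_nonneg _) (eucNorm_nonneg _) (eucNorm_nonneg _) (h₁ k') (nb k) (nc k') (nd k)
    have e2 : eucNorm (a' k') * eucNorm (b k - b' k) * eucNorm (c k') * eucNorm (d k) ≤ 1 * ε₂ * 1 * 1 :=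
      prod4_le (eucNorm_nonneg _) (eucNorm_nonneg _) (eucNorm_nonneg _) (eucNorm_nonneg _) (na' k') (h₂ k) (nc k') (nd k)
    have e3 : eucNorm (a' k') * eucNorm (b' k) * eucNorm (c k' - c' k') * eucNorm (d k) ≤ 1 * 1 * ε₃ * 1 :=
      prod4_le (eucNorm_nonneg _) (eucNorm_nonneg _) (eucNorm_nonneg _) (eucNorm_nonneg _) (na' k') (nb' k) (h₃ k') (nd k)
    have e4 : eucNorm (a' k') * eucNorm (b' k) * eucNorm (c' k') * eucNorm (d k - d' k) ≤ 1 * 1 * 1 * ε₄ :=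
      prod4_le (eucNorm_nonneg _) (eucNorm_nonneg _) (eucNorm_nonneg _) (eucNorm_nonneg _) (na' k') (nb' k) (nc' k') (h₄ k)
    linarith
  -- sum over the four pairs
  rw [← Finset.sum_sub_distrib]
  simp only [← Finset.sum_sub_distrib]
  have hn : ‖∑ k' : Fin 2, ∑ k : Fin 2, (pairResolvent hH E (a k') (b k) (c k') (d k) -
      pairResolvent hH E (a' k') (b' k) (c' k') (d' k))‖ ≤
      ∑ k' : Fin 2, ∑ k : Fin 2, ‖pairResolvent hH E (a k') (b k) (c k') (d k) -
        pairResolvent hH E (a' k') (b' k) (c' k') (d' k)‖ :=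
    (norm_sum_le _ _).trans (Finset.sum_le_sum fun k' _ => norm_sum_le _ _)
  have hs : (θ₁ + θ₂ - E) * ∑ k' : Fin 2, ∑ k : Fin 2, ‖pairResolvent hH E (a k') (b k) (c k') (d k) -
      pairResolvent hH E (a' k') (b' k) (c' k') (d' k)‖ ≤ 4 * (ε₁ + ε₂ + ε₃ + ε₄) := by
    simp only [Fin.sum_univ_two, mul_add]
    have := one 0 0; have := one 0 1; have := one 1 0; have := one 1 1
    linarith
  exact (mul_le_mul_of_nonneg_left hn hg.le).trans hs

/-- **Scalars pull out of the family sum**: `Σ_{k',k} K(x₁•a, x₂•b, x₃•c, x₄•d) = x̄₁ x₂ x̄₃ x₄ · Σ_{k',k} K(a,b,c,d)`.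
[folklore] -/
theorem pairResolvent_family_smul {H : Matrix m m ℂ} (hH : H.IsHermitian) (E : ℝ) (x₁ x₂ x₃ x₄ : ℂ)
    (a c b d : Fin 2 → m → ℂ) :
    (∑ k' : Fin 2, ∑ k : Fin 2, pairResolvent hH E (x₁ • a k') (x₂ • b k) (x₃ • c k') (x₄ • d k)) =
      (star x₁ * x₂ * star x₃ * x₄) * ∑ k' : Fin 2, ∑ k : Fin 2, pairResolvent hH E (a k') (b k) (c k') (d k) := by
  rw [Finset.mul_sum]
  refine Finset.sum_congr rfl fun k' _ => ?_
  rw [Finset.mul_sum]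
  refine Finset.sum_congr rfl fun k _ => ?_
  rw [pairResolvent_smul₁, pairResolvent_smul₂, pairResolvent_smul₃, pairResolvent_smul₄]
  ring

omit [DecidableEq m] in
/-- **Projection onto a trial vector.** For a unit vector `φ` and a vector `ψ` of squared norm `n > 0`, with the
projection coefficient `β = ⟨ψ, φ⟩/n`: `‖φ - β • ψ‖² = 1 - |⟨ψ, φ⟩|²/n`. [folklore] -/
theorem eucNorm_sub_proj_sq' {φ ψ : m → ℂ} (hφ1 : star φ ⬝ᵥ φ = 1) {n : ℝ} (hn : 0 < n)
    (hψ : (star ψ ⬝ᵥ ψ).re = n) :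
    eucNorm (φ - ((star ψ ⬝ᵥ φ) / (n : ℂ)) • ψ) ^ 2 = 1 - ‖star ψ ⬝ᵥ φ‖ ^ 2 / n := by
  set γ : ℂ := star ψ ⬝ᵥ φ with hγ
  have hψψ : star ψ ⬝ᵥ ψ = (n : ℂ) := by
    rw [star_dotProduct_self_eq_eucNorm_sq, eucNorm_sq, hψ]
  have hφψ : star φ ⬝ᵥ ψ = star γ := by rw [hγ, star_dotProduct]
  have hn' : (n : ℂ) ≠ 0 := by exact_mod_cast hn.ne'
  have h : star (φ - (γ / (n : ℂ)) • ψ) ⬝ᵥ (φ - (γ / (n : ℂ)) • ψ) = 1 - star γ * γ / (n : ℂ) := by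
    simp only [star_sub, star_smul, sub_dotProduct, smul_dotProduct, dotProduct_sub, dotProduct_smul, smul_eq_mul,
      hφ1, hφψ, hψψ, star_div₀, Complex.star_def, Complex.conj_ofReal]
    rw [← hγ]
    field_simp
    ring
  have := congrArg Complex.re h
  rw [← eucNorm_sq, star_mul_self_eq_normSq, Complex.sub_re, Complex.one_re, ← Complex.ofReal_div,
    Complex.ofReal_re] at this
  exact this

omit [DecidableEq m] in
/-- The projected component has norm at most one: `‖(⟨ψ,φ⟩/n) • ψ‖ ≤ 1` for a unit `φ` and `‖ψ‖² = n > 0`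
(Cauchy–Schwarz). [folklore] -/
theorem norm_proj_coeff_smul_le {φ ψ : m → ℂ} (hφ1 : star φ ⬝ᵥ φ = 1) {n : ℝ} (hn : 0 < n)
    (hψ : (star ψ ⬝ᵥ ψ).re = n) (O : Matrix m m ℂ) (hO : ∀ v, eucNorm (O *ᵥ v) ≤ eucNorm v) :
    eucNorm (((star ψ ⬝ᵥ φ) / (n : ℂ)) • (O *ᵥ ψ)) ≤ 1 := by
  have hψn : eucNorm ψ = Real.sqrt n := by
    rw [← Real.sqrt_sq (eucNorm_nonneg ψ), eucNorm_sq, hψ]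
  have hcs : ‖star ψ ⬝ᵥ φ‖ ≤ Real.sqrt n := by
    have h := norm_star_dotProduct_le ψ φ
    rwa [hψn, eucNorm_eq_one hφ1, mul_one] at h
  rw [eucNorm_smul, norm_div, Complex.norm_real, Real.norm_of_nonneg hn.le]
  have hOψ : eucNorm (O *ᵥ ψ) ≤ Real.sqrt n := (hO ψ).trans hψn.le
  have hsq : Real.sqrt n * Real.sqrt n = n := Real.mul_self_sqrt hn.le
  have h1 : ‖star ψ ⬝ᵥ φ‖ / n * eucNorm (O *ᵥ ψ) ≤ Real.sqrt n / n * Real.sqrt n :=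
    mul_le_mul (div_le_div_of_nonneg_right hcs hn.le) hOψ (eucNorm_nonneg _)
      (div_nonneg (Real.sqrt_nonneg _) hn.le)
  have h2 : Real.sqrt n / n * Real.sqrt n = 1 := by
    rw [div_mul_eq_mul_div, hsq, div_self hn.ne']
  linarith

omit [DecidableEq m] in
/-- The difference of the operator-inserted state and its trial version: `‖O φ - (⟨ψ,φ⟩/n) • O ψ‖ ≤ ε` whenever
`1 - |⟨ψ,φ⟩|²/n ≤ ε²` (`O` a contraction, `φ` unit, `‖ψ‖² = n`). [folklore] -/
theorem norm_insert_sub_proj_le {φ ψ : m → ℂ} (hφ1 : star φ ⬝ᵥ φ = 1) {n : ℝ} (hn : 0 < n)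
    (hψ : (star ψ ⬝ᵥ ψ).re = n) (O : Matrix m m ℂ) (hO : ∀ v, eucNorm (O *ᵥ v) ≤ eucNorm v) {ε : ℝ} (hε : 0 ≤ ε)
    (hdef : 1 - ‖star ψ ⬝ᵥ φ‖ ^ 2 / n ≤ ε ^ 2) :
    eucNorm (O *ᵥ φ - ((star ψ ⬝ᵥ φ) / (n : ℂ)) • (O *ᵥ ψ)) ≤ ε := by
  have h : O *ᵥ φ - ((star ψ ⬝ᵥ φ) / (n : ℂ)) • (O *ᵥ ψ) = O *ᵥ (φ - ((star ψ ⬝ᵥ φ) / (n : ℂ)) • ψ) := by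
    rw [mulVec_sub, mulVec_smul]
  rw [h]
  refine (hO _).trans ?_
  have hsq := eucNorm_sub_proj_sq' hφ1 hn hψ
  nlinarith [eucNorm_nonneg (φ - ((star ψ ⬝ᵥ φ) / (n : ℂ)) • ψ)]

end Generic

end Summit.HubbardSuperconductivity.HubbardSuperconductivity.Theorems.LevyLogBootstrap

end
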